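import Literature.AlgebraicGeometry.Deformation.SmoothSchemeLiftObstructionCriterionGluedScheme
import Literature.AlgebraicGeometry.Deformation.SmoothSchemeLiftObstructionCriterionGlueBaseChange
import HarnessLib

/-!
# Gluing the lifted charts, VII: the change-of-coefficients morphism of glued deformations and its cartesian charts
# (Hartshorne, *Deformation Theory*, proof of Thm. 10.2 (a); `X'_{R'} → X'_R` over `Spec R' → Spec R`)

HOME SEED (cell `hodgecm-mathlib`, F-11 (A3) F3b FILE 4b; provisional path
`Deformation/SmoothSchemeLiftObstructionCriterionGlueReduction.lean`).  Theorems only; imports FILE 3 and FILE 4a.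

For a `k`-algebra map `σ : R → R'`, cocycle-exact lifted gluing data `ψ` over `R` and `ψ'` over `R'` on the SAME cover that
are COMPATIBLE (`(σ ⊗ 1) ∘ ψ j l = ψ' j l ∘ (σ ⊗ 1)` — for the reduction `A → A⧸J` of a small extension this says that `ψ`
lifts `ψ'`), the chart maps `φ j = Spec (σ ⊗ 1) : Spec (R' ⊗_k Γ(U j)) → Spec (R ⊗_k Γ(U j))` form a MORPHISM OF GLUE DATA
with CARTESIAN chart squares (FILE 4a), hence (★ `Morphisms/GlueDataOverBase` §2):

* `chartOverlap_baseChange` — the overlaps correspond, `W'_{jl} = φ_j⁻¹ W_{jl}`;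
* `baseChange_transitionMap` — the transition maps are compatible;
* **`existsUnique_baseChangeMap`** — a unique `Φ : X'_{R'} ⟶ X'_R` with `ι' j ≫ Φ = φ j ≫ ι j`;
* **`isPullback_ι_baseChangeMap`** — every chart square `Spec (R' ⊗_k Γ(U j)) → X'_{R'}`, `Spec (R ⊗_k Γ(U j)) → X'_R` is
  CARTESIAN (★ `glueData_isPullback_ι_map`);
* `baseChangeMap_comp_structureMap` — `Φ` lies over `Spec σ : Spec R' → Spec R`.

(The global square `X'_{R'} = X'_R ×_{Spec R} Spec R'` then follows chart by chart; with `R' = k`, `ψ' = 1` the source is the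
re-glued closed fibre — sequel.)
HC_CM is proved only modulo the 7 printed citations until rung 0 closes — nothing here bears on a summit statement.

## References
* [Hartshorne2010] R. Hartshorne, *Deformation Theory*, GTM 257, Springer (2010): Thm. 10.2 (a) and its proof (p. 81).
* [StacksProject] The Stacks Project, Tag 01JA (glueing schemes; functoriality), Tag 01LH (relative glueing).
-/

noncomputable section

-- `TopCat.Presheaf`/`TopCat.Sheaf` are not reducible (as in Mathlib's `AlgebraicGeometry/Modules`).
set_option backward.isDefEq.respectTransparency false

open CategoryTheory AlgebraicGeometry Opposite TopologicalSpace Limits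
open scoped TensorProduct

universe u

namespace Literature.AlgebraicGeometry.Deformation

open Literature.AlgebraicGeometry.Motives Literature.AlgebraicGeometry.Morphisms

variable {k : Type u} [Field k] {X : Over (Spec (CommRingCat.of k))}
  [instΓ : ∀ W : X.left.Opens, Algebra k Γ(X.left, W)]
  (halg : ∀ (W : X.left.Opens) (s : k), algebraMap k Γ(X.left, W) s = (constToPresheaf X).app (op W) s)
  {R R' : Type u} [CommRing R] [Algebra k R] [CommRing R'] [Algebra k R'] (σ : R →ₐ[k] R')
  {ι : Type u} (U : ι → X.left.affineOpens) (b : (j l : ι) → Γ(X.left, (U j).1))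
  (hb : ∀ j l, (U j).1 ⊓ (U l).1 = X.left.basicOpen (b j l))
  (ψ : (j l : ι) → R ⊗[k] Γ(X.left, (U j).1 ⊓ (U l).1) ≃ₐ[R] R ⊗[k] Γ(X.left, (U j).1 ⊓ (U l).1))
  (ψ' : (j l : ι) → R' ⊗[k] Γ(X.left, (U j).1 ⊓ (U l).1) ≃ₐ[R'] R' ⊗[k] Γ(X.left, (U j).1 ⊓ (U l).1))
  (𝔫 : Ideal R) (h𝔫 : IsNilpotent 𝔫) (𝔫' : Ideal R') (h𝔫' : IsNilpotent 𝔫')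
  (hψ : ∀ j l x, ψ j l x - x ∈ 𝔫 • (⊤ : Submodule R (R ⊗[k] Γ(X.left, (U j).1 ⊓ (U l).1))))
  (hψ' : ∀ j l x, ψ' j l x - x ∈ 𝔫' • (⊤ : Submodule R' (R' ⊗[k] Γ(X.left, (U j).1 ⊓ (U l).1))))
  (hcoc : ∀ (j l m : ι)
    (Φjl : R ⊗[k] Γ(X.left, (U j).1 ⊓ (U l).1) →ₐ[R] R ⊗[k] Γ(X.left, (U j).1 ⊓ (U l).1 ⊓ (U m).1))
    (_ : ∀ a s, Φjl (a ⊗ₜ s) = a ⊗ₜ X.left.presheaf.map (homOfLE inf_le_left).op s)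
    (Φlm : R ⊗[k] Γ(X.left, (U l).1 ⊓ (U m).1) →ₐ[R] R ⊗[k] Γ(X.left, (U j).1 ⊓ (U l).1 ⊓ (U m).1))
    (_ : ∀ a s, Φlm (a ⊗ₜ s) = a ⊗ₜ X.left.presheaf.map
      (homOfLE (le_inf (inf_le_left.trans inf_le_right) inf_le_right)).op s)
    (Φjm : R ⊗[k] Γ(X.left, (U j).1 ⊓ (U m).1) →ₐ[R] R ⊗[k] Γ(X.left, (U j).1 ⊓ (U l).1 ⊓ (U m).1))
    (_ : ∀ a s, Φjm (a ⊗ₜ s) = a ⊗ₜ X.left.presheaf.map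
      (homOfLE (le_inf (inf_le_left.trans inf_le_left) inf_le_right)).op s)
    (ρjl ρlm ρjm : R ⊗[k] Γ(X.left, (U j).1 ⊓ (U l).1 ⊓ (U m).1) ≃ₐ[R]
      R ⊗[k] Γ(X.left, (U j).1 ⊓ (U l).1 ⊓ (U m).1)),
    (∀ x, ρjl (Φjl x) = Φjl (ψ j l x)) → (∀ x, ρlm (Φlm x) = Φlm (ψ l m x)) →
    (∀ x, ρjm (Φjm x) = Φjm (ψ j m x)) → ρlm * ρjl = ρjm)
  (hcoc' : ∀ (j l m : ι)
    (Φjl : R' ⊗[k] Γ(X.left, (U j).1 ⊓ (U l).1) →ₐ[R'] R' ⊗[k] Γ(X.left, (U j).1 ⊓ (U l).1 ⊓ (U m).1))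
    (_ : ∀ a s, Φjl (a ⊗ₜ s) = a ⊗ₜ X.left.presheaf.map (homOfLE inf_le_left).op s)
    (Φlm : R' ⊗[k] Γ(X.left, (U l).1 ⊓ (U m).1) →ₐ[R'] R' ⊗[k] Γ(X.left, (U j).1 ⊓ (U l).1 ⊓ (U m).1))
    (_ : ∀ a s, Φlm (a ⊗ₜ s) = a ⊗ₜ X.left.presheaf.map
      (homOfLE (le_inf (inf_le_left.trans inf_le_right) inf_le_right)).op s)
    (Φjm : R' ⊗[k] Γ(X.left, (U j).1 ⊓ (U m).1) →ₐ[R'] R' ⊗[k] Γ(X.left, (U j).1 ⊓ (U l).1 ⊓ (U m).1))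
    (_ : ∀ a s, Φjm (a ⊗ₜ s) = a ⊗ₜ X.left.presheaf.map
      (homOfLE (le_inf (inf_le_left.trans inf_le_left) inf_le_right)).op s)
    (ρjl ρlm ρjm : R' ⊗[k] Γ(X.left, (U j).1 ⊓ (U l).1 ⊓ (U m).1) ≃ₐ[R']
      R' ⊗[k] Γ(X.left, (U j).1 ⊓ (U l).1 ⊓ (U m).1)),
    (∀ x, ρjl (Φjl x) = Φjl (ψ' j l x)) → (∀ x, ρlm (Φlm x) = Φlm (ψ' l m x)) →
    (∀ x, ρjm (Φjm x) = Φjm (ψ' j m x)) → ρlm * ρjl = ρjm)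
  (hψσ : ∀ j l x, Algebra.TensorProduct.map σ (AlgHom.id k Γ(X.left, (U j).1 ⊓ (U l).1)) (ψ j l x) =
    ψ' j l (Algebra.TensorProduct.map σ (AlgHom.id k Γ(X.left, (U j).1 ⊓ (U l).1)) x))

/-! ## §1 The chart maps `φ j = Spec (σ ⊗ 1)` and the overlaps -/

omit instΓ in
/-- `(σ ⊗ 1) (r ⊗ c) = σ r ⊗ c`. [cite: AtiyahMacdonald1969, Ch. 2 (tensor product of algebras, pp. 30–31)] -/
theorem map_toRingHom_tmul [∀ W : X.left.Opens, Algebra k Γ(X.left, W)] (V : X.left.Opens) (r : R) (c : Γ(X.left, V)) :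
    (Algebra.TensorProduct.map σ (AlgHom.id k Γ(X.left, V))).toRingHom (r ⊗ₜ c) = σ r ⊗ₜ c :=
  Algebra.TensorProduct.map_tmul _ _ _ _

/-- **The overlaps correspond**: `W'_{jl} = φ_j⁻¹ W_{jl}` for `φ j = Spec (σ ⊗ 1)`. [cite: StacksProject, Tag 01JA] -/
theorem chartOverlap_baseChange (j l : ι) : chartOverlap R' U j l =
    Spec.map (CommRingCat.ofHom (Algebra.TensorProduct.map σ (AlgHom.id k Γ(X.left, (U j).1))).toRingHom) ⁻¹ᵁ
      chartOverlap R U j l := by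
  rw [chartOverlap_eq, chartOverlap_eq, preimage_SpecMap_baseChange σ (U j).2 (chartProj R U j) rfl (chartProj R' U j) rfl
    (map_toRingHom_tmul σ (U j).1)]

/-! ## §2 The transition maps are compatible -/

include hb h𝔫 h𝔫' hψ hψ' hψσ in
/-- **The transition maps are compatible with the chart maps**: `(W' ≅ φ⁻¹W ⟶ W) ≫ t_R = t_{R'} ≫ φ_l`.
[cite: StacksProject, Tag 01JA] [cite: Hartshorne2010, Thm. 10.2 (proof), p. 81] -/
theorem baseChange_transitionMap (j l : ι) :
    (Scheme.isoOfEq _ (chartOverlap_baseChange σ U j l)).hom ≫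
      (Spec.map (CommRingCat.ofHom (Algebra.TensorProduct.map σ (AlgHom.id k Γ(X.left, (U j).1))).toRingHom) ∣_
        chartOverlap R U j l) ≫ transitionMap halg R U ψ j l =
      transitionMap halg R' U ψ' j l ≫
        Spec.map (CommRingCat.ofHom (Algebra.TensorProduct.map σ (AlgHom.id k Γ(X.left, (U l).1))).toRingHom) := by
  have _ := hb; have _ := h𝔫; have _ := h𝔫'; have _ := hψ; have _ := hψ'
  rw [transitionMap_eq, transitionMap_eq, ← Category.assoc]
  exact baseChange_transition σ (U j).2 (chartProj R U j) rfl (chartProj R' U j) rfl (map_toRingHom_tmul σ (U j).1) _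
    (by rw [Category.assoc, morphismRestrict_ι, Scheme.isoOfEq_hom_ι_assoc])
    (overlapRingHom_tmul_one halg R U j l) (overlapRingHom_one_tmul halg R U j l)
    (overlapRingHom_tmul_one halg R' U j l) (overlapRingHom_one_tmul halg R' U j l)
    (map_toRingHom_tmul σ ((U j).1 ⊓ (U l).1)) (map_toRingHom_tmul σ (U l).1) (ψ j l) (ψ' j l) (hψσ j l)
    (baseChangeRight_tmul halg R U j l) (baseChangeRight_tmul halg R' U j l)

/-! ## §3 The morphism of glued schemes and its cartesian charts -/

set_option maxHeartbeats 800000 in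
include hψσ in
/-- **THE CHANGE-OF-COEFFICIENTS MORPHISM** `Φ : X'_{R'} ⟶ X'_R`: a unique morphism of the glued schemes restricting to
`φ j = Spec (σ ⊗ 1)` on every chart (★ `glueData_existsUnique_map`). [cite: StacksProject, Tag 01JA] [cite: Hartshorne2010, Thm. 10.2 (proof), p. 81] -/
theorem existsUnique_baseChangeMap :
    ∃! Φ : (deformationGlueDatum halg R' U b hb ψ' 𝔫' h𝔫' hψ' hcoc').glueData.glued ⟶
        (deformationGlueDatum halg R U b hb ψ 𝔫 h𝔫 hψ hcoc).glueData.glued,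
      ∀ j, (deformationGlueDatum halg R' U b hb ψ' 𝔫' h𝔫' hψ' hcoc').glueData.ι j ≫ Φ =
        Spec.map (CommRingCat.ofHom (Algebra.TensorProduct.map σ (AlgHom.id k Γ(X.left, (U j).1))).toRingHom) ≫
          (deformationGlueDatum halg R U b hb ψ 𝔫 h𝔫 hψ hcoc).glueData.ι j := by
  refine glueData_existsUnique_map (D₁ := (deformationGlueDatum halg R' U b hb ψ' 𝔫' h𝔫' hψ' hcoc').glueData)
    (D₂ := (deformationGlueDatum halg R U b hb ψ 𝔫 h𝔫 hψ hcoc).glueData) (e := id)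
    (φ := fun j => Spec.map (CommRingCat.ofHom
      (Algebra.TensorProduct.map σ (AlgHom.id k Γ(X.left, (U j).1))).toRingHom))
    (φV := fun j l => (Scheme.isoOfEq _ (chartOverlap_baseChange σ U j l)).hom ≫
      (Spec.map (CommRingCat.ofHom (Algebra.TensorProduct.map σ (AlgHom.id k Γ(X.left, (U j).1))).toRingHom) ∣_
        chartOverlap R U j l))
    (fun j l => ?_) (fun j l => ?_)
  · -- compatibility with the overlap inclusions
    change (_ ≫ _) ≫ (chartOverlap R U j l).ι = (chartOverlap R' U j l).ι ≫ _
    rw [Category.assoc, morphismRestrict_ι, Scheme.isoOfEq_hom_ι_assoc]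
  · -- compatibility with the transition maps (compare after the monomorphism `(W l j).ι`)
    rw [← cancel_mono ((deformationGlueDatum halg R U b hb ψ 𝔫 h𝔫 hψ hcoc).W l j).ι]
    have h1 : (deformationGlueDatum halg R U b hb ψ 𝔫 h𝔫 hψ hcoc).tLift j l ≫
        ((deformationGlueDatum halg R U b hb ψ 𝔫 h𝔫 hψ hcoc).W l j).ι = transitionMap halg R U ψ j l :=
      (deformationGlueDatum halg R U b hb ψ 𝔫 h𝔫 hψ hcoc).tLift_ι j l
    have h2 : (Spec.map (CommRingCat.ofHom
        (Algebra.TensorProduct.map σ (AlgHom.id k Γ(X.left, (U l).1))).toRingHom) ∣_ chartOverlap R U l j) ≫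
        ((deformationGlueDatum halg R U b hb ψ 𝔫 h𝔫 hψ hcoc).W l j).ι =
        (Spec.map (CommRingCat.ofHom (Algebra.TensorProduct.map σ (AlgHom.id k Γ(X.left, (U l).1))).toRingHom) ⁻¹ᵁ
          chartOverlap R U l j).ι ≫
          Spec.map (CommRingCat.ofHom (Algebra.TensorProduct.map σ (AlgHom.id k Γ(X.left, (U l).1))).toRingHom) :=
      morphismRestrict_ι _ _
    have h3 : (Scheme.isoOfEq _ (chartOverlap_baseChange σ U l j)).hom ≫
        (Spec.map (CommRingCat.ofHom (Algebra.TensorProduct.map σ (AlgHom.id k Γ(X.left, (U l).1))).toRingHom) ⁻¹ᵁ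
          chartOverlap R U l j).ι = ((deformationGlueDatum halg R' U b hb ψ' 𝔫' h𝔫' hψ' hcoc').W l j).ι :=
      Scheme.isoOfEq_hom_ι _ _
    have h4 : (deformationGlueDatum halg R' U b hb ψ' 𝔫' h𝔫' hψ' hcoc').tLift j l ≫
        ((deformationGlueDatum halg R' U b hb ψ' 𝔫' h𝔫' hψ' hcoc').W l j).ι = transitionMap halg R' U ψ' j l :=
      (deformationGlueDatum halg R' U b hb ψ' 𝔫' h𝔫' hψ' hcoc').tLift_ι j l
    simp only [Category.assoc, OpensGlueDatum.glueData_t, id_eq]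
    rw [h1, h2, ← Category.assoc (Scheme.isoOfEq _ (chartOverlap_baseChange σ U l j)).hom, h3,
      ← Category.assoc ((deformationGlueDatum halg R' U b hb ψ' 𝔫' h𝔫' hψ' hcoc').tLift j l), h4]
    exact ((Category.assoc _ _ _).trans (baseChange_transitionMap halg σ U b hb ψ ψ' 𝔫 h𝔫 𝔫' h𝔫' hψ hψ' hψσ j l))

/-- **The chart squares are CARTESIAN**: `Spec (R' ⊗_k Γ(U j)) = X'_{R'} ×_{X'_R} Spec (R ⊗_k Γ(U j))`
(★ `glueData_isPullback_ι_map`; the overlap squares are the pull-backs of opens). [cite: StacksProject, Tag 01LH] [cite: Hartshorne2010, Thm. 10.2 (proof), p. 81] -/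
theorem isPullback_ι_baseChangeMap
    (Φ : (deformationGlueDatum halg R' U b hb ψ' 𝔫' h𝔫' hψ' hcoc').glueData.glued ⟶
      (deformationGlueDatum halg R U b hb ψ 𝔫 h𝔫 hψ hcoc).glueData.glued)
    (hΦ : ∀ j, (deformationGlueDatum halg R' U b hb ψ' 𝔫' h𝔫' hψ' hcoc').glueData.ι j ≫ Φ =
      Spec.map (CommRingCat.ofHom (Algebra.TensorProduct.map σ (AlgHom.id k Γ(X.left, (U j).1))).toRingHom) ≫
        (deformationGlueDatum halg R U b hb ψ 𝔫 h𝔫 hψ hcoc).glueData.ι j) (j : ι) :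
    IsPullback ((deformationGlueDatum halg R' U b hb ψ' 𝔫' h𝔫' hψ' hcoc').glueData.ι j)
      (Spec.map (CommRingCat.ofHom (Algebra.TensorProduct.map σ (AlgHom.id k Γ(X.left, (U j).1))).toRingHom)) Φ
      ((deformationGlueDatum halg R U b hb ψ 𝔫 h𝔫 hψ hcoc).glueData.ι j) := by
  refine glueData_isPullback_ι_map (D₁ := (deformationGlueDatum halg R' U b hb ψ' 𝔫' h𝔫' hψ' hcoc').glueData)
    (D₂ := (deformationGlueDatum halg R U b hb ψ 𝔫 h𝔫 hψ hcoc).glueData) (e := id)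
    (φ := fun j => Spec.map (CommRingCat.ofHom
      (Algebra.TensorProduct.map σ (AlgHom.id k Γ(X.left, (U j).1))).toRingHom))
    (φV := fun j l => (Scheme.isoOfEq _ (chartOverlap_baseChange σ U j l)).hom ≫
      (Spec.map (CommRingCat.ofHom (Algebra.TensorProduct.map σ (AlgHom.id k Γ(X.left, (U j).1))).toRingHom) ∣_
        chartOverlap R U j l))
    (fun j l => ?_) Φ hΦ j
  -- the square `W' = φ⁻¹ W → W`, `C' → C` is the pull-back of the open `W`, transported along `W' = φ⁻¹ W`
  exact (isPullback_morphismRestrict _ (chartOverlap R U j l)).flip.of_iso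
    (Scheme.isoOfEq _ (chartOverlap_baseChange σ U j l)).symm (Iso.refl _) (Iso.refl _) (Iso.refl _)
    (by rw [Iso.refl_hom, Category.comp_id]; exact (Scheme.isoOfEq_inv_ι _ (chartOverlap_baseChange σ U j l)).symm)
    (by rw [Iso.refl_hom, Category.comp_id, Iso.symm_hom, Iso.inv_hom_id_assoc])
    (by rw [Iso.refl_hom, Iso.refl_hom, Category.comp_id, Category.id_comp])
    (by rw [Iso.refl_hom, Iso.refl_hom, Category.comp_id, Category.id_comp]; rfl)

include hψσ in
/-- **`Φ` lies over `Spec σ : Spec R' → Spec R`**: `Φ ≫ q = q' ≫ Spec σ` for the structure maps of FILE 3 (both sides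
restrict on the chart `j` to `Spec (σ ⊗ 1) ≫ Spec (r ↦ r ⊗ 1) = Spec (r' ↦ r' ⊗ 1) ≫ Spec σ`).
[cite: StacksProject, Tag 01LH] [cite: Hartshorne2010, Thm. 10.2 (proof), p. 81] -/
theorem baseChangeMap_comp_structureMap
    (Φ : (deformationGlueDatum halg R' U b hb ψ' 𝔫' h𝔫' hψ' hcoc').glueData.glued ⟶
      (deformationGlueDatum halg R U b hb ψ 𝔫 h𝔫 hψ hcoc).glueData.glued)
    (hΦ : ∀ j, (deformationGlueDatum halg R' U b hb ψ' 𝔫' h𝔫' hψ' hcoc').glueData.ι j ≫ Φ =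
      Spec.map (CommRingCat.ofHom (Algebra.TensorProduct.map σ (AlgHom.id k Γ(X.left, (U j).1))).toRingHom) ≫
        (deformationGlueDatum halg R U b hb ψ 𝔫 h𝔫 hψ hcoc).glueData.ι j)
    (q : (deformationGlueDatum halg R U b hb ψ 𝔫 h𝔫 hψ hcoc).glueData.glued ⟶ Spec (CommRingCat.of R))
    (hq : ∀ j, (deformationGlueDatum halg R U b hb ψ 𝔫 h𝔫 hψ hcoc).glueData.ι j ≫ q =
      Spec.map (CommRingCat.ofHom (Algebra.TensorProduct.includeLeftRingHom (R := k) (A := R) (B := Γ(X.left, (U j).1)))))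
    (q' : (deformationGlueDatum halg R' U b hb ψ' 𝔫' h𝔫' hψ' hcoc').glueData.glued ⟶ Spec (CommRingCat.of R'))
    (hq' : ∀ j, (deformationGlueDatum halg R' U b hb ψ' 𝔫' h𝔫' hψ' hcoc').glueData.ι j ≫ q' =
      Spec.map (CommRingCat.ofHom (Algebra.TensorProduct.includeLeftRingHom (R := k) (A := R') (B := Γ(X.left, (U j).1))))) :
    Φ ≫ q = q' ≫ Spec.map (CommRingCat.ofHom σ.toRingHom) := by
  have _ := hψσ
  refine glueData_hom_ext _ _ _ fun j => ?_
  have e : (Algebra.TensorProduct.map σ (AlgHom.id k Γ(X.left, (U j).1))).toRingHom.comp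
      (Algebra.TensorProduct.includeLeftRingHom (R := k) (A := R) (B := Γ(X.left, (U j).1))) =
      (Algebra.TensorProduct.includeLeftRingHom (R := k) (A := R') (B := Γ(X.left, (U j).1))).comp σ.toRingHom :=
    RingHom.ext fun r => map_toRingHom_tmul σ (U j).1 r 1
  rw [← Category.assoc, hΦ, Category.assoc, hq, ← Category.assoc, hq', ← Spec.map_comp, ← Spec.map_comp,
    ← CommRingCat.ofHom_comp, ← CommRingCat.ofHom_comp, e]

end Literature.AlgebraicGeometry.Deformation

end
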